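import Literature.Probability.LatticeModels.DobrushinCellWeightedDecay
import Summits.QuantumFields.QCD.Theses.HeatSlicedQuarks

/-!
# Stub `stub_cellDobrushinDecay` (3a) of line `two-scale-lsi-handover`
(crux `Summit.QuantumFields.QCD.Theses.HeatSlicedQuarks.RobustYangMillsHandover`, item stmt-QuantumFields-8892;
lead reshape r1, 2026-08-16)

**Dobrushin's comparison with an exponentially WEIGHTED received-sum condition, for a general specification
read through cells** — the abstract engine of the reshaped line: single-cell kernels `γ_{Λ_x}`,
`Λ_x = {v | cell v = x}`, TV / oscillation influence coefficients `C y x ≥ 0`, a Gibbs measure `ν`, bounded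
measurable `f, g` reading the cells `Δf, Δg`, a weight `θ ≥ 0` with `θ ≥ 1` on `Δg`, and `c₀ < 1` bounding the
plain and the `θ`-weighted received sums off `Δg` give
`|ν(fg) − ν(f)ν(g)| ≤ 8 B_f B_g |Δg| Σ_{x ∈ Δf} θ x`.
This is the registered signature verbatim; the proof is the Literature theorem
`Literature.Probability.LatticeModels.DobrushinShlosman.abs_integral_mul_sub_le_of_weighted_influence`
(`DobrushinCellWeightedDecay.lean`: Föllmer's Lemma (2.5) in vector form on cells, the weighted contraction of
Georgii's Remark 8.26, and the tilt trick of Föllmer's Theorem (2.13)).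
-/

namespace Summit.QuantumFields.QCD.Cruxes.RobustYangMillsHandover.TwoScaleLsiHandover

open MeasureTheory

/-- **stub_cellDobrushinDecay** (3a of line `two-scale-lsi-handover`): covariance decay under the plain and
the exponentially weighted Dobrushin received-sum conditions, for a general specification read through cells,
influence coefficients in the TV / oscillation form. [cite: Follmer1988, Ch. I Theorem (2.13)]
[cite: Georgii2011, Remark 8.26] [cite: Kunsch1982] -/
theorem stub_cellDobrushinDecay :
  ∀ (ι V S : Type) [Fintype ι] [DecidableEq ι] [Fintype V] [DecidableEq V] [MeasurableSpace S]
    (cell : V → ι) (γ : Literature.Probability.LatticeModels.Specification V S),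
    Literature.Probability.LatticeModels.IsSpecification γ →
    ∀ (C : ι → ι → ℝ), (∀ y x, 0 ≤ C y x) →
    (∀ (x y : ι), y ≠ x → ∀ (ω η : V → S), (∀ v, cell v ≠ y → ω v = η v) →
      ∀ (f : (V → S) → ℝ) (δ : ℝ), Measurable f → (∃ B : ℝ, ∀ σ, |f σ| ≤ B) →
        DependsOn f {v | cell v = x} → 0 ≤ δ →
        (∀ σ τ : V → S, (∀ v, cell v ≠ x → σ v = τ v) → |f σ - f τ| ≤ δ) →
          |(∫ σ, f σ ∂(γ (Finset.univ.filter fun v => cell v = x) ω)) -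
              ∫ σ, f σ ∂(γ (Finset.univ.filter fun v => cell v = x) η)| ≤ C y x * δ) →
    ∀ (ν : MeasureTheory.Measure (V → S)), Literature.Probability.LatticeModels.IsGibbsMeasure γ ν →
    ∀ (f g : (V → S) → ℝ) (Δf Δg : Finset ι) (Bf Bg : ℝ),
      Measurable f → Measurable g → (∀ σ, |f σ| ≤ Bf) → (∀ σ, |g σ| ≤ Bg) →
      DependsOn f {v | cell v ∈ Δf} → DependsOn g {v | cell v ∈ Δg} →
    ∀ (θ : ι → ℝ) (c₀ : ℝ), (∀ x, 0 ≤ θ x) → (∀ x ∈ Δg, 1 ≤ θ x) → 0 ≤ c₀ → c₀ < 1 →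
      (∀ x, x ∉ Δg → ∑ y, C y x ≤ c₀) → (∀ x, x ∉ Δg → ∑ y, C y x * θ y ≤ c₀ * θ x) →
        |∫ σ, f σ * g σ ∂ν - (∫ σ, f σ ∂ν) * ∫ σ, g σ ∂ν| ≤
          8 * Bf * Bg * Δg.card * ∑ x ∈ Δf, θ x :=
  fun _ _ _ _ _ _ _ _ cell _ hγ _ hC0 hC _ hν _ _ _ _ _ _ hfm hgm hBf hBg hfdep hgdep _ _ hθ0 hθ1 hc0 hc1
      hrow hroww =>
    Literature.Probability.LatticeModels.DobrushinShlosman.abs_integral_mul_sub_le_of_weighted_influence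
      cell hγ hC0 hC hν hfm hgm hBf hBg hfdep hgdep hθ0 hθ1 hc0 hc1 hrow hroww

end Summit.QuantumFields.QCD.Cruxes.RobustYangMillsHandover.TwoScaleLsiHandover
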